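import Literature.NumberTheory.Sieve.HeathBrownCubicApproxU2Bounds
import Literature.NumberTheory.Sieve.HeathBrownCubicUpperBoundProofs
import HarnessLib

/-!
# Heath-Brown's Lemma 3.7 from the corrected Lemma 7.1 — assembly

Pure-proof file (no definitions) closing the deduction of **Lemma 3.7 from the corrected Lemma 7.1**
of D. R. Heath-Brown, *Primes represented by `x³ + 2y³`*, Acta Math. 186 (2001), 1–84, §7 pp. 42–47
(decomposition of **parity.S18**, `Literature.NumberTheory.Sieve.setOf_prime_cube_add_two_mul_cube_infinite`).

Lemma 3.7 (`HeathBrown2001_lemma_3_7` of `HeathBrownCubicTypeII`) consists of ten bounds — for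
`∑_{n ≥ 3} |U^(n) − Û^(n)|`, `|U₁^(1) − Û₁^(1)|`, `|U₁^(2) − Û₁^(2)|`, `|S₄ − Ŝ₄|`, `|U₂^(1) − Û₂^(1)|`,
each for `𝒜^(K)` and for `ℬ^(K)` — which the previous files derive one family of pieces at a time
from the corrected, ideal-weighted Lemma 7.1 (`HeathBrown2001_lemma_7_1_normWeighted` of
`HeathBrownCubicUpperBound`): `S4_A_bound`, `S4_B_bound` (`HeathBrownCubicApproxS4`), `U_A_bounds`
(`HeathBrownCubicApproxUA`), `U_B_bounds` (`HeathBrownCubicApproxUB`), `U2_A_bound`, `U2_B_bound`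
(`HeathBrownCubicApproxU2Bounds`), all with the quantifier structure of the lemma
(`∀ ϖ ∈ (0, 1/5) ∃ C X₀ ∀ X ≥ X₀ ∀ η` in (2.1)). Here they are put together:

* **`HeathBrown2001_lemma_3_7_of_lemma_7_1 : HeathBrown2001_lemma_7_1_normWeighted → HeathBrown2001_lemma_3_7`**
  (take the largest constant and threshold);
* **`Literature.NumberTheory.Sieve.setOf_prime_cube_add_two_mul_cube_infinite_of_sieveFacts`** —
  parity.S18 from Lemma 3.5, the corrected Lemma 7.1 and Lemmas 3.8, 3.9, 3.10 (Landau's prime ideal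
  theorem and Lemma 3.4 being proved in the tree, Lemma 3.6 and now Lemma 3.7 being derived from
  Lemma 7.1): the frontier of parity.S18 is the Fundamental-Lemma bound (Lemma 3.5), the Selberg
  upper bound over `K` (Lemma 7.1), the Siegel–Walfisz analogue (Lemma 3.8), the leading parts
  (Lemma 3.9) and the Type II large-sieve estimate (Lemma 3.10).

## References

* D. R. Heath-Brown, *Primes represented by `x³ + 2y³`*, Acta Math. 186 (2001), 1–84: Lemma 3.7
  (p. 17) and §7 pp. 42–47; Theorem (p. 2). [cite: HeathBrownActa2001, Lemma 3.7]
* G. Harman, *Prime-Detecting Sieves*, LMS Monographs 33, Princeton (2007), §13.2. [cite: Harman2007, §13.2]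

## Mathlib / tree search

Tree: `HeathBrownCubicApproxS4` (`S4_A_bound`, `S4_B_bound`), `HeathBrownCubicApproxUA` (`U_A_bounds`),
`HeathBrownCubicApproxUB` (`U_B_bounds`), `HeathBrownCubicApproxU2Bounds` (`U2_A_bound`, `U2_B_bound`),
`HeathBrownCubicUpperBoundProofs` (`setOf_prime_cube_add_two_mul_cube_infinite_of_lemma_7_1`).
-/

noncomputable section

open Polynomial NumberField Finset Filter Topology Asymptotics
open scoped nonZeroDivisors

namespace Literature.NumberTheory.Sieve.CubicSieve

open LFunctions.CubeRootTwoField CubicPrimes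

/-- The scales of Lemma 3.7 are non-negative for `X ≥ 16`, `τ = (log log X)^{−ϖ}` (then
`log log X > 0`, `τ > 0`, `ξτ^{-4} = τ ≥ 0`, `log X > 0`). [folklore] -/
theorem lemma_3_7_scales_nonneg {ϖ X η : ℝ} (hX : (16 : ℝ) ≤ X) (hη : 0 ≤ η) :
    0 ≤ hbXi (hbTau ϖ X) / hbTau ϖ X ^ 4 * (η ^ 2 * X ^ 2 / Real.log X) ∧
      0 ≤ hbXi (hbTau ϖ X) / hbTau ϖ X ^ 4 * (η * X ^ 3 / Real.log X) := by
  have he : Real.exp 1 < 16 := by have := Real.exp_one_lt_d9; linarith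
  have hL1 : 1 < Real.log X := by
    rw [← Real.log_exp 1]; exact Real.log_lt_log (Real.exp_pos 1) (by linarith)
  have hLL : 0 < Real.log (Real.log X) := Real.log_pos hL1
  have hτ0 : 0 < hbTau ϖ X := by rw [hbTau]; exact Real.rpow_pos_of_pos hLL _
  have hscale : hbXi (hbTau ϖ X) / hbTau ϖ X ^ 4 = hbTau ϖ X := hbXi_div_pow_four hτ0.ne'
  rw [hscale]
  have hX0 : 0 < X := by linarith
  have hL0 : 0 < Real.log X := by linarith
  exact ⟨by positivity, by positivity⟩

/-- **Heath-Brown's Lemma 3.7 from the corrected Lemma 7.1** (§7, pp. 42–47: "The following lemma,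
whose proof uses simple sieve upper bounds, estimates the errors involved in all these
approximations", p. 17): all ten conjuncts, with the common constant the maximum of the six
constants of `S4_A_bound`, `S4_B_bound`, `U_A_bounds`, `U_B_bounds`, `U2_A_bound`, `U2_B_bound`.
[cite: HeathBrownActa2001, Lemma 3.7] -/
theorem HeathBrown2001_lemma_3_7_of_lemma_7_1 (h71 : HeathBrown2001_lemma_7_1_normWeighted) :
    HeathBrown2001_lemma_3_7 := by
  intro ϖ hϖ0 hϖ1
  obtain ⟨C₁, X₁, h1⟩ := S4_A_bound h71 hϖ0 hϖ1
  obtain ⟨C₂, X₂, h2⟩ := S4_B_bound h71 hϖ0 hϖ1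
  obtain ⟨C₃, X₃, h3⟩ := U_A_bounds h71 hϖ0 hϖ1
  obtain ⟨C₄, X₄, h4⟩ := U_B_bounds h71 hϖ0 hϖ1
  obtain ⟨C₅, X₅, h5⟩ := U2_A_bound h71 hϖ0 hϖ1
  obtain ⟨C₆, X₆, h6⟩ := U2_B_bound h71 hϖ0 hϖ1
  have hC1 : C₁ ≤ max (max (max C₁ C₂) (max C₃ C₄)) (max C₅ C₆) :=
    le_trans (le_trans (le_max_left C₁ C₂) (le_max_left _ (max C₃ C₄))) (le_max_left _ _)
  have hC2 : C₂ ≤ max (max (max C₁ C₂) (max C₃ C₄)) (max C₅ C₆) :=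
    le_trans (le_trans (le_max_right C₁ C₂) (le_max_left _ (max C₃ C₄))) (le_max_left _ _)
  have hC3 : C₃ ≤ max (max (max C₁ C₂) (max C₃ C₄)) (max C₅ C₆) :=
    le_trans (le_trans (le_max_left C₃ C₄) (le_max_right (max C₁ C₂) _)) (le_max_left _ _)
  have hC4 : C₄ ≤ max (max (max C₁ C₂) (max C₃ C₄)) (max C₅ C₆) :=
    le_trans (le_trans (le_max_right C₃ C₄) (le_max_right (max C₁ C₂) _)) (le_max_left _ _)
  have hC5 : C₅ ≤ max (max (max C₁ C₂) (max C₃ C₄)) (max C₅ C₆) :=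
    le_trans (le_max_left C₅ C₆) (le_max_right _ _)
  have hC6 : C₆ ≤ max (max (max C₁ C₂) (max C₃ C₄)) (max C₅ C₆) :=
    le_trans (le_max_right C₅ C₆) (le_max_right _ _)
  refine ⟨max (max (max C₁ C₂) (max C₃ C₄)) (max C₅ C₆),
    max (max (max (max X₁ X₂) (max X₃ X₄)) (max X₅ X₆)) 16, fun X η hX hη hη1 => ?_⟩
  have hX16 : (16 : ℝ) ≤ X := le_trans (le_max_right _ _) hX
  have hXm : max (max (max X₁ X₂) (max X₃ X₄)) (max X₅ X₆) ≤ X := le_trans (le_max_left _ _) hX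
  have hX1 : X₁ ≤ X :=
    le_trans (le_trans (le_trans (le_max_left X₁ X₂) (le_max_left _ (max X₃ X₄))) (le_max_left _ (max X₅ X₆))) hXm
  have hX2 : X₂ ≤ X :=
    le_trans (le_trans (le_trans (le_max_right X₁ X₂) (le_max_left _ (max X₃ X₄))) (le_max_left _ (max X₅ X₆))) hXm
  have hX3 : X₃ ≤ X :=
    le_trans (le_trans (le_trans (le_max_left X₃ X₄) (le_max_right (max X₁ X₂) _)) (le_max_left _ (max X₅ X₆))) hXm
  have hX4 : X₄ ≤ X :=
    le_trans (le_trans (le_trans (le_max_right X₃ X₄) (le_max_right (max X₁ X₂) _)) (le_max_left _ (max X₅ X₆))) hXm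
  have hX5 : X₅ ≤ X := le_trans (le_trans (le_max_left X₅ X₆) (le_max_right (max (max X₁ X₂) (max X₃ X₄)) _)) hXm
  have hX6 : X₆ ≤ X := le_trans (le_trans (le_max_right X₅ X₆) (le_max_right (max (max X₁ X₂) (max X₃ X₄)) _)) hXm
  have hη0 : 0 ≤ η := le_trans (Real.exp_pos _).le hη
  obtain ⟨hFA, hFB⟩ := lemma_3_7_scales_nonneg (ϖ := ϖ) hX16 hη0
  have k : ∀ {S c A B : ℝ}, 0 ≤ A * B → S ≤ c * A * B → c ≤ max (max (max C₁ C₂) (max C₃ C₄)) (max C₅ C₆) →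
      S ≤ max (max (max C₁ C₂) (max C₃ C₄)) (max C₅ C₆) * A * B := by
    intro S c A B hF hS hc
    rw [mul_assoc] at hS ⊢
    exact hS.trans (mul_le_mul_of_nonneg_right hc hF)
  obtain ⟨h3a, h3b, h3c⟩ := h3 X η hX3 hη hη1
  obtain ⟨h4a, h4b, h4c⟩ := h4 X η hX4 hη hη1
  exact ⟨k hFA h3a hC3, k hFA h3b hC3, k hFA h3c hC3, k hFA (h1 X η hX1 hη hη1) hC1,
    k hFA (h5 X η hX5 hη hη1) hC5, k hFB h4a hC4, k hFB h4b hC4, k hFB h4c hC4,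
    k hFB (h2 X η hX2 hη hη1) hC2, k hFB (h6 X η hX6 hη hη1) hC6⟩

/-- **parity.S18 from Lemma 3.5, the corrected Lemma 7.1 and Lemmas 3.8, 3.9, 3.10 of Heath-Brown's
paper** — the frontier after this file: Landau's prime ideal theorem and Lemma 3.4 are proved in the
tree, and Lemmas 3.6 and 3.7 are supplied by `HeathBrown2001_lemma_3_6_of_lemma_7_1` and
`HeathBrown2001_lemma_3_7_of_lemma_7_1`. [cite: HeathBrownActa2001, Theorem (p. 2)] -/
theorem _root_.Literature.NumberTheory.Sieve.setOf_prime_cube_add_two_mul_cube_infinite_of_sieveFacts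
    (h35 : HeathBrown2001_lemma_3_5) (h71 : HeathBrown2001_lemma_7_1_normWeighted)
    (h38 : HeathBrown2001_lemma_3_8) (h39 : HeathBrown2001_lemma_3_9)
    (h310 : HeathBrown2001_lemma_3_10) :
    Literature.NumberTheory.Sieve.setOf_prime_cube_add_two_mul_cube_infinite :=
  Literature.NumberTheory.Sieve.setOf_prime_cube_add_two_mul_cube_infinite_of_lemma_7_1 h35 h71
    (HeathBrown2001_lemma_3_7_of_lemma_7_1 h71) h38 h39 h310

end Literature.NumberTheory.Sieve.CubicSieve

end
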